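import Summits.AtomisticToContinuum.Crystallization.Theses.HolmgrenBoyleLind
import Summits.AtomisticToContinuum.Crystallization.Theorems.ExcessDecayLiouvilleForceBalance
import Summits.AtomisticToContinuum.Crystallization.Theorems.ExcessDecayLiouvilleForceTail

/-!
# Crux `HolmgrenBoyleLind.GroundStatesChargeFLCEquilibrium` (stmt-AtomisticToContinuum-6076), line
# `registered` (skeleton `Lines/birth.lean`) — stub 3a `stub_groundStateNearForce`

NEAR-FIELD FORCE BOUND INSIDE LENNARD-JONES GROUND STATES (Fermat + far-field tail). There are
`δ₀ > 0` and `C` such that every Lennard-Jones ground state `x : Fin N → ℝ³` is `δ₀`-separated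
(uniformly in `N`) and, for every particle `k`, every radius `ρ ≥ 1` and every finite index set
`B ∌ k` containing all `j ≠ k` with `dist (x j) (x k) < ρ`, the force exerted on `x k` by the
particles of `B` has norm `≤ C/ρ⁴`.

Proof: `δ` from `LennardJonesMinimalDistance_holds`, `δ₀ := min δ 1`, `C := 2048/δ₀³`. Fermat
(`ExcessDecayLiouvilleForceBalance.sum_erase_force_eq_zero`) gives `Σ_{j ≠ k} F_j = 0`, so
`Σ_B F = −Σ_{(univ.erase k) \ B} F` (`Finset.sum_sdiff`); the complement consists of particles at
distance `≥ ρ` from `x k`, pairwise `δ₀`-separated, so the finite force tail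
`ExcessDecayLiouville.sum_norm_ljForce_le_of_separated` (over the image finset, `x` injective)
bounds the sum of the norms by `2048/(δ₀³ρ⁴) = C/ρ⁴`. All `[folklore]`; helper file for item
stmt-AtomisticToContinuum-6076, nothing here closes an item.
-/

noncomputable section

namespace Summit.AtomisticToContinuum.Crystallization.Theorems.HolmgrenBoyleLindGroundStatesChargeFLCEquilibrium

open Literature.MathematicalPhysics.StatisticalMechanics
open Summit.AtomisticToContinuum.Crystallization.Theorems.ExcessDecayLiouville
open Summit.AtomisticToContinuum.Crystallization.Theorems.ExcessDecayLiouvilleForceBalance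

/-- **Far field of the force inside a separated finite configuration.** If `x : Fin N → ℝ³` is
`δ₀`-separated (`0 < δ₀ ≤ ρ`, `1 ≤ ρ`) and every index of `S` is a particle at distance `≥ ρ` from
`x k`, then `Σ_{j ∈ S} ‖F_{kj}‖ ≤ 2048/(δ₀³ρ⁴)` (the finite force tail
`sum_norm_ljForce_le_of_separated` transported along the injective map `x`). [folklore] -/
theorem sum_norm_force_le_of_far_index {N : ℕ} {x : Fin N → EuclideanSpace ℝ (Fin 3)} {δ₀ ρ : ℝ}
    (hδ₀ : 0 < δ₀) (hδ₀ρ : δ₀ ≤ ρ) (hρ : 1 ≤ ρ)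
    (hsep : ∀ a b : Fin N, a ≠ b → δ₀ ≤ dist (x a) (x b)) (k : Fin N) (S : Finset (Fin N))
    (hfar : ∀ j ∈ S, ρ ≤ dist (x j) (x k)) :
    ∑ j ∈ S, ‖(deriv lennardJones (dist (x k) (x j)) / dist (x k) (x j)) • (x k - x j)‖ ≤
      2048 / (δ₀ ^ 3 * ρ ^ 4) := by
  classical
  have hinj : Function.Injective x := by
    intro i j hij
    by_contra hne
    have h := hsep i j hne
    rw [hij, dist_self] at h
    exact lt_irrefl _ (hδ₀.trans_le h)
  have himg : Set.InjOn x S := hinj.injOn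
  have h := sum_norm_ljForce_le_of_separated (S.image x) (x k) hδ₀ hδ₀ρ hρ ?_ ?_
  · rwa [Finset.sum_image himg] at h
  · intro a ha b hb hab
    obtain ⟨i, -, rfl⟩ := Finset.mem_image.1 ha
    obtain ⟨j, -, rfl⟩ := Finset.mem_image.1 hb
    exact hsep i j fun hij => hab (by rw [hij])
  · intro a ha
    obtain ⟨j, hj, rfl⟩ := Finset.mem_image.1 ha
    exact hfar j hj

/-- **Stub 3a — near-field force bound inside ground states (Fermat + far-field tail).** There are
`δ₀ > 0` and `C` such that every Lennard-Jones ground state `x : Fin N → ℝ³` is `δ₀`-separated and,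
for every particle `k`, every radius `ρ ≥ 1` and every finite index set `B ∌ k` containing all
`j ≠ k` with `dist (x j) (x k) < ρ`, the force exerted on `x k` by the particles of `B` has norm
`≤ C/ρ⁴`: `δ₀ := min δ_LJ 1` (`LennardJonesMinimalDistance_holds`), `C := 2048/δ₀³`; Fermat
`sum_erase_force_eq_zero` gives `Σ_{j ≠ k} F = 0`, so `Σ_B F = −Σ_{(univ.erase k) \ B} F`, and the
complement is a `δ₀`-separated far field at distance `≥ ρ` (`sum_norm_force_le_of_far_index`).
[folklore] -/
theorem stub_groundStateNearForce :
    ∃ δ₀ C : ℝ, 0 < δ₀ ∧ ∀ (N : ℕ) (x : Fin N → EuclideanSpace ℝ (Fin 3)),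
      IsGroundState lennardJones x →
        (∀ a b : Fin N, a ≠ b → δ₀ ≤ dist (x a) (x b)) ∧
        ∀ (k : Fin N) (ρ : ℝ), 1 ≤ ρ → ∀ B : Finset (Fin N), k ∉ B →
          (∀ j : Fin N, j ≠ k → dist (x j) (x k) < ρ → j ∈ B) →
          ‖∑ j ∈ B, (deriv lennardJones (dist (x k) (x j)) / dist (x k) (x j)) • (x k - x j)‖ ≤
            C / ρ ^ 4 := by
  classical
  obtain ⟨δ, hδ, hsepδ⟩ := LennardJonesMinimalDistance_holds
  have hδ₀ : 0 < min δ 1 := lt_min hδ one_pos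
  have hδ₀δ : min δ 1 ≤ δ := min_le_left _ _
  have hδ₀1 : min δ 1 ≤ 1 := min_le_right _ _
  refine ⟨min δ 1, 2048 / min δ 1 ^ 3, hδ₀, fun N x hx => ?_⟩
  have hsep : ∀ a b : Fin N, a ≠ b → min δ 1 ≤ dist (x a) (x b) :=
    fun a b hab => hδ₀δ.trans (hsepδ N x hx a b hab)
  refine ⟨hsep, fun k ρ hρ B hkB hB => ?_⟩
  -- Fermat at `k` and the splitting `univ.erase k = B ⊔ (univ.erase k \ B)`
  have hBS : B ⊆ Finset.univ.erase k := fun j hj =>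
    Finset.mem_erase.2 ⟨fun h => hkB (h ▸ hj), Finset.mem_univ j⟩
  have hsplit := Finset.sum_sdiff hBS
    (f := fun j => (deriv lennardJones (dist (x k) (x j)) / dist (x k) (x j)) • (x k - x j))
  rw [sum_erase_force_eq_zero hx k] at hsplit
  have hBeq := eq_neg_of_add_eq_zero_right hsplit
  -- the complement is the far field
  have hfar : ∀ j ∈ Finset.univ.erase k \ B, ρ ≤ dist (x j) (x k) := by
    intro j hj
    rw [Finset.mem_sdiff, Finset.mem_erase] at hj
    exact not_lt.1 fun hlt => hj.2 (hB j hj.1.1 hlt)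
  have htail := sum_norm_force_le_of_far_index hδ₀ (hδ₀1.trans hρ) hρ hsep k
    (Finset.univ.erase k \ B) hfar
  calc ‖∑ j ∈ B, (deriv lennardJones (dist (x k) (x j)) / dist (x k) (x j)) • (x k - x j)‖
      = ‖∑ j ∈ Finset.univ.erase k \ B,
          (deriv lennardJones (dist (x k) (x j)) / dist (x k) (x j)) • (x k - x j)‖ := by
        rw [hBeq, norm_neg]
    _ ≤ ∑ j ∈ Finset.univ.erase k \ B,
          ‖(deriv lennardJones (dist (x k) (x j)) / dist (x k) (x j)) • (x k - x j)‖ :=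
        norm_sum_le _ _
    _ ≤ 2048 / (min δ 1 ^ 3 * ρ ^ 4) := htail
    _ = 2048 / min δ 1 ^ 3 / ρ ^ 4 := (div_div _ _ _).symm

end Summit.AtomisticToContinuum.Crystallization.Theorems.HolmgrenBoyleLindGroundStatesChargeFLCEquilibrium

end
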